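import Summits.PneNP.PneNP.Theorems.ConvexRankGatesLinAlgGateBlindGRankSpanDim

/-!
# Route ConvexRankGates, crux `LinAlgGateBlind` (stmt-PneNP-10681): the linear-matroid rank door — "are `θ` of the live vectors independent?" up to `θ ≤ m^{7/8-o(1)}`

Support theorems for the crux (vocabulary of `Theorems/ConvexRankGatesLinAlgGateBlindDefs.lean`). Which sub-classes of the
generic-rank gates reach the full union-bound range `m^{7/8-o(1)}` of the PERM door, rather than the `m^{7/16-o(1)}` of the
general GRANK door (`sgAt_gRank_logWidth`, cover exponent `s²`)? The tree has: span programs (`sgAt_spanGateOver_logWidth`,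
exponent `D`), Kőnig / bipartite matching gates (`…KonigLogWidth`, exponent `2d`). This file adds the LINEAR-MATROID RANK
THRESHOLD gates `[θ ≤ dim span {u_i : v_i = 1}]`, vectors `u_i` in ANY space `F^D` over ANY division ring, threshold
`θ ≤ t` ("`θ` of the live vectors are linearly independent"; with `u_i = e_{colour(i)}`: "the live inputs show `≥ θ`
colours"), with cover exponent `t`:

* `exists_subset_card_le_finrank_span_image` — few spanning vectors, counted by the dimension of the span of the sub-family
  itself;
* `sgAt_linRank_of_chain_budget` — finite SG form for the inline class `LINRANK_t`: a rejected graph has live span of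
  dimension `< θ ≤ t`, spanned by `< θ` live atoms; the all-off events of the spans of `≤ t` atoms of dimension `< θ` cover
  the rejection region (`≤ #𝒱(l)^t` events);
* `sgAt_linRank_logWidth`, `isTermGate_linRank_collapse`, `not_computes_clique_of_isOver_linRank_logWidth` — for every `c`,
  eventually in `m`, for every `t ≤ m^{7/8}/(log₂ m)^5`: the single-gate statement and the unconditional lower bound — no
  circuit with `≤ m^c` gates over `{∧₂, ∨₂} ∪ LINRANK_t` computes `CLIQUE(m, ⌈m^{1/8}⌉)`.

(With a second generic factor, `K_i = u_i w_iᵀ`, these are GRANK gates; as GRANK gates of threshold `t` the tree's door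
gives only `t² ≤ m^{7/8}/(log₂ m)^5`.) Sources: Razborov 1985, Alon–Boppana 1987 §3; planting theorem, host and budgets
are the tree's. No new definitions (the class is written inline). [folklore]
-/

-- `Summit.PneNP.PneNP.…` duplicates `PneNP` BY DESIGN (single-problem summit).
set_option linter.dupNamespace false

noncomputable section

namespace Summit.PneNP.PneNP.Theorems

open Finset Filter Literature.Computability.Complexity Razborov
open Summit.PneNP.PneNP.Cruxes.LinAlgGateBlind.DnfInvariantWideGatesSeeSmallCliques
open Summit.PneNP.PneNP.Cruxes.LinAlgGateBlind.DnfInvariantWideGatesSeeSmallCliques.DenseRegime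

/-! ### Few spanning vectors, counted by the dimension of their own span -/

/-- **Few spanning vectors suffice, counted by the dimension of the span of the sub-family.** From `r i, i ∈ I` one can
select `J ⊆ I` with the same span and `#J ≤ dim span{r i : i ∈ I}` (`exists_subset_card_le_finrank_span_range` for the
family restricted to `I`). [folklore] -/
theorem exists_subset_card_le_finrank_span_image {F V ι : Type*} [DivisionRing F] [AddCommGroup V] [Module F V]
    [DecidableEq ι] (r : ι → V) (I : Finset ι) :
    ∃ J ⊆ I, #J ≤ Module.finrank F (Submodule.span F (r '' (I : Set ι))) ∧
      Submodule.span F (r '' (J : Set ι)) = Submodule.span F (r '' (I : Set ι)) := by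
  classical
  obtain ⟨J', -, hcard, hJ'⟩ :=
    exists_subset_card_le_finrank_span_range (F := F) (fun i : {i // i ∈ I} => r i) univ
  have hrange : Set.range (fun i : {i // i ∈ I} => r i) = r '' (I : Set ι) := by
    ext y
    constructor
    · rintro ⟨⟨i, hi⟩, rfl⟩
      exact ⟨i, hi, rfl⟩
    · rintro ⟨i, hi, rfl⟩
      exact ⟨⟨i, hi⟩, rfl⟩
  have himg : ∀ T : Finset {i // i ∈ I},
      (fun i : {i // i ∈ I} => r i) '' (T : Set {i // i ∈ I}) = r '' ((T.map (Function.Embedding.subtype _) :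
        Finset ι) : Set ι) := by
    intro T
    ext y
    simp only [Set.mem_image, Finset.mem_coe, Finset.mem_map, Function.Embedding.coe_subtype]
    constructor
    · rintro ⟨⟨i, hi⟩, hT, rfl⟩
      exact ⟨i, ⟨⟨i, hi⟩, hT, rfl⟩, rfl⟩
    · rintro ⟨i, ⟨⟨i', hi'⟩, hT, rfl⟩, rfl⟩
      exact ⟨⟨i', hi'⟩, hT, rfl⟩
  refine ⟨J'.map (Function.Embedding.subtype _), fun i hi => ?_, ?_, ?_⟩
  · obtain ⟨⟨i', hi'⟩, -, rfl⟩ := Finset.mem_map.1 hi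
    exact hi'
  · rw [card_map, ← hrange]
    exact hcard
  · have hset : (((univ : Finset {i // i ∈ I}).map (Function.Embedding.subtype _) : Finset ι) : Set ι) =
        (I : Set ι) := by
      ext i
      simp only [Finset.coe_map, Function.Embedding.coe_subtype, Finset.coe_univ, Set.image_univ, Set.mem_range,
        Finset.mem_coe]
      constructor
      · rintro ⟨⟨i', hi'⟩, rfl⟩
        exact hi'
      · intro hi
        exact ⟨⟨i, hi⟩, rfl⟩
    rw [← himg J', hJ', himg univ, hset]

/-! ### SG for linear-matroid rank threshold gates from the span cover -/

/-- **The span cover of a rank-threshold term gate (finite form of SG for `LINRANK_t`).** Let `q ∈ [0,1]`,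
`1 - q^{C(l,2)} ≤ 1/2`, `0 < ε`, `2tt ≤ l`, the positive budget `(ν·C(l,2))^{tt} · C(m-tt, k-tt) ≤ ε·C(m,k)` and the fragility
budget `#𝒱(l)^t · (1/2)^{ν+1} · #𝒱(l) < ε`. Then `SGAt` holds for the inline class `LINRANK_t` of gates
`[θ ≤ dim span{u_i : v_i = 1}]`, `θ ≤ t`, vectors in any `F^D` over any division ring: for a `t`-tuple of atoms `f` put
`W_f = span{u_a : X_a ∈ range f}`; a graph is rejected iff for some `f` with `dim W_f < θ` every atom `X_a` with
`u_a ∉ W_f` is absent ((⇐) the live span lies in `W_f`; (⇒) the live span has dimension `< θ ≤ t` and is spanned by that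
many live atoms, `exists_subset_card_le_finrank_span_image`, listed padded with `∅`). The planting theorem `sg_of_maxtermCover`
concludes. [folklore] -/
theorem sgAt_linRank_of_chain_budget : ∀ (m l k t ν tt : ℕ) (q ε : ℝ), 0 ≤ q → q ≤ 1 →
    1 - q ^ (l.choose 2) ≤ 1 / 2 → 0 < ε → 2 * tt ≤ l →
    (((ν * l.choose 2) ^ tt * (m - tt).choose (k - tt) : ℕ) : ℝ) ≤ ε * (m.choose k : ℝ) →
    (#(smallSets (Fin m) l) : ℝ) ^ t * (1 / 2) ^ (ν + 1) * #(smallSets (Fin m) l) < ε →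
    SGAt m (fun g => ∃ (F : Type) (_ : DivisionRing F) (D θ : ℕ), θ ≤ t ∧ ∃ u : Fin g.1 → (Fin D → F),
      ∀ v : Fin g.1 → Bool, g.2 v = true ↔
        θ ≤ Module.finrank F (Submodule.span F (u '' {i | v i = true}))) l k q ε := by
  intro m l k t ν tt q ε hq0 hq1 hql hε htl hpos hfrag O hO
  classical
  obtain ⟨g, ⟨F, _, D, θ, hθt, u, hg⟩, X, hX, hOX⟩ := hO
  set V := smallSets (Fin m) l with hVdef
  have hV : (0 : ℝ) < #V := Nat.cast_pos.2 (card_pos.2 ⟨∅, empty_mem_smallSets l⟩)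
  -- the live vectors of a graph
  have hlive_set : ∀ x, {i | (fun a => atomB (X a) x) i = true} = {a | CliquePresent (X a) x} := by
    intro x
    ext a
    simp [atomB]
  -- the span of the vectors of the atoms listed by `f`
  set W : (Fin t → V) → Submodule F (Fin D → F) :=
    fun f => Submodule.span F (u '' {a | ∃ i, ((f i : V) : Finset (Fin m)) = X a}) with hWdef
  -- the span cover
  have hiff : ∀ x, O x = false ↔
      ∃ f : Fin t → V, Module.finrank F (W f) < θ ∧ ∀ a, u a ∉ W f → ¬ CliquePresent (X a) x := by
    intro x
    constructor
    · intro h0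
      have hlt : Module.finrank F (Submodule.span F (u '' {a | CliquePresent (X a) x})) < θ := by
        by_contra hge
        have htrue : g.2 (fun a => atomB (X a) x) = true := (hg _).2 (by rw [hlive_set x]; omega)
        rw [← hOX x, h0] at htrue
        exact Bool.false_ne_true htrue
      -- few live atoms span the live span
      obtain ⟨J, hJI, hJcard, hJ⟩ :=
        exists_subset_card_le_finrank_span_image (F := F) u (univ.filter fun a => CliquePresent (X a) x)
      have hIset : ((univ.filter fun a => CliquePresent (X a) x : Finset (Fin g.1)) : Set (Fin g.1)) =
          {a | CliquePresent (X a) x} := by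
        ext a
        simp
      rw [hIset] at hJ hJcard
      -- the atoms of `J`, listed as a `t`-tuple padded with `∅`
      set 𝒥 : Finset (Finset (Fin m)) := J.image X with h𝒥def
      have h𝒥V : 𝒥 ⊆ V := by
        intro Y hY
        obtain ⟨a, -, rfl⟩ := mem_image.1 hY
        exact hX a
      have h𝒥card : #𝒥 ≤ t := card_image_le.trans (hJcard.trans (by omega))
      set e𝒥 := 𝒥.equivFin with he𝒥
      set f : Fin t → V := fun i =>
        if h : (i : ℕ) < #𝒥 then ⟨(e𝒥.symm ⟨i, h⟩ : Finset (Fin m)), h𝒥V (e𝒥.symm ⟨i, h⟩).2⟩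
        else ⟨∅, empty_mem_smallSets l⟩ with hfdef
      have hf_live : ∀ a, (∃ i, ((f i : V) : Finset (Fin m)) = X a) → CliquePresent (X a) x := by
        rintro a ⟨i, hi⟩
        by_cases h : (i : ℕ) < #𝒥
        · have hmem : X a ∈ 𝒥 := by
            rw [← hi, hfdef]
            simp only [h, dif_pos]
            exact (e𝒥.symm ⟨i, h⟩).2
          obtain ⟨b, hb, hba⟩ := mem_image.1 hmem
          have hb_live : CliquePresent (X b) x := (mem_filter.1 (hJI hb)).2
          rw [← hba]
          exact hb_live
        · have hempty : X a = ∅ := by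
            rw [← hi, hfdef]
            simp only [h, dif_neg, not_false_eq_true]
          rw [hempty]
          exact cliquePresent_empty x
      have hJ_listed : ∀ b ∈ J, ∃ i, ((f i : V) : Finset (Fin m)) = X b := by
        intro b hb
        have hXb : X b ∈ 𝒥 := mem_image_of_mem X hb
        refine ⟨⟨e𝒥 ⟨X b, hXb⟩, lt_of_lt_of_le (e𝒥 ⟨X b, hXb⟩).2 h𝒥card⟩, ?_⟩
        rw [hfdef]
        simp only [(e𝒥 ⟨X b, hXb⟩).2, dif_pos, Fin.eta, Equiv.symm_apply_apply]
      have hWf : W f = Submodule.span F (u '' {a | CliquePresent (X a) x}) := by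
        apply le_antisymm
        · refine Submodule.span_le.2 ?_
          rintro _ ⟨a, ha, rfl⟩
          exact Submodule.subset_span ⟨a, hf_live a ha, rfl⟩
        · rw [← hJ]
          exact Submodule.span_mono (Set.image_mono fun b hb => hJ_listed b hb)
      refine ⟨f, by rw [hWf]; exact hlt, fun a ha hla => ha ?_⟩
      rw [hWf]
      exact Submodule.subset_span ⟨a, hla, rfl⟩
    · rintro ⟨f, hdim, hf⟩
      have hle : Submodule.span F (u '' {a | CliquePresent (X a) x}) ≤ W f := by
        refine Submodule.span_le.2 ?_
        rintro _ ⟨a, ha, rfl⟩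
        by_contra hW
        exact hf a hW ha
      have hlt : Module.finrank F (Submodule.span F (u '' {a | CliquePresent (X a) x})) < θ :=
        (Submodule.finrank_mono hle).trans_lt hdim
      rw [hOX x]
      cases hv : g.2 (fun a => atomB (X a) x)
      · rfl
      · exfalso
        have hge := (hg _).1 hv
        rw [hlive_set x] at hge
        omega
  -- index the span cover
  set J := {f : Fin t → V // Module.finrank F (W f) < θ} with hJ
  set N := Nat.card J with hNdef
  set e : J ≃ Fin N := Finite.equivFin J with he
  set 𝓛 : Fin N → Finset (Finset (Fin m)) :=
    fun j => (univ.filter fun a => u a ∉ W (e.symm j).1).image X with h𝓛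
  have hNle : (N : ℝ) ≤ (#V : ℝ) ^ t := by
    have h1 : N ≤ Nat.card (Fin t → V) :=
      Nat.card_le_card_of_injective (Subtype.val : J → (Fin t → V)) Subtype.val_injective
    have h2 : Nat.card (Fin t → V) = #V ^ t := by
      rw [Nat.card_eq_fintype_card, Fintype.card_fun, Fintype.card_fin, Fintype.card_coe]
    rw [h2] at h1
    exact_mod_cast h1
  have hN : (N : ℝ) * (1 / 2) ^ (ν + 1) < ε / #V := by
    rw [lt_div_iff₀ hV]
    calc (N : ℝ) * (1 / 2) ^ (ν + 1) * #V ≤ (#V : ℝ) ^ t * (1 / 2) ^ (ν + 1) * #V := by gcongr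
      _ < ε := hfrag
  have h1 : ∀ j, 𝓛 j ⊆ V := by
    intro j Y hY
    obtain ⟨a, -, rfl⟩ := mem_image.1 hY
    exact hX a
  have h2 : ∀ x, O x = false → ∃ j, ∀ Y ∈ 𝓛 j, ¬ CliquePresent Y x := by
    intro x hx
    obtain ⟨f, hdim, hf⟩ := (hiff x).1 hx
    refine ⟨e ⟨f, hdim⟩, fun Y hY => ?_⟩
    obtain ⟨a, ha, rfl⟩ := mem_image.1 hY
    rw [mem_filter, Equiv.symm_apply_apply] at ha
    exact hf a ha.2
  have h3 : ∀ j x, (∀ Y ∈ 𝓛 j, ¬ CliquePresent Y x) → O x = false := fun j x hall =>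
    (hiff x).2 ⟨(e.symm j).1, (e.symm j).2, fun a ha =>
      hall (X a) (mem_image_of_mem X (mem_filter.2 ⟨mem_univ a, ha⟩))⟩
  obtain ⟨𝒜, h𝒜, hP, hNg⟩ := sg_of_maxtermCover m l k N ν tt q (ε / #V) O 𝓛 h1 h2 h3
    hq0 hq1 hql (div_pos hε hV) hN htl
  refine ⟨𝒜, h𝒜, ?_, hNg.trans_eq (mul_div_cancel₀ ε hV.ne')⟩
  calc (#(lostPos m k O 𝒜) : ℝ) ≤ (((ν * l.choose 2) ^ tt * (m - tt).choose (k - tt) : ℕ) : ℝ) := by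
        exact_mod_cast hP
    _ ≤ ε * (m.choose k : ℝ) := hpos

/-! ### At logarithmic width -/

/-- **`SGAt` for `LINRANK_t`, `t ≤ m^{7/8}/(log₂ m)^5`, at the logarithmic width, at every level `c`, eventually in `m`**:
`sgAt_linRank_of_chain_budget` with the budgets of `logWidth_common` at `T = Λ·L·(t+1)` and the cover budget
`#𝒱(L)^t 2^{-(ν+1)} #𝒱(L) < ε` (`cover_budget_two_pow`). [folklore] -/
theorem sgAt_linRank_logWidth : ∀ c : ℕ, ∀ᶠ m : ℕ in atTop, ∀ t : ℕ,
    (t : ℝ) ≤ (m : ℝ) ^ (7 / 8 : ℝ) / Real.logb 2 m ^ 5 →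
      SGAt m (fun g => ∃ (F : Type) (_ : DivisionRing F) (D θ : ℕ), θ ≤ t ∧ ∃ u : Fin g.1 → (Fin D → F),
          ∀ v : Fin g.1 → Bool, g.2 v = true ↔
            θ ≤ Module.finrank F (Submodule.span F (u '' {i | v i = true})))
        ((2 * c + 8) * (Nat.log 2 m + 1)) (kOf m) (qOf m) (epsOf c m) := by
  intro c
  filter_upwards [logWidth_common c] with m hm t ht
  have hT : ((((Nat.log 2 m + 1) * ((2 * c + 8) * (Nat.log 2 m + 1)) * (t + 1) : ℕ) : ℝ)) ≤
      16 * ((c : ℝ) + 4) * Real.logb 2 m ^ 2 * ((m : ℝ) ^ (7 / 8 : ℝ) / Real.logb 2 m ^ 5) := by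
    obtain ⟨-, -, -, -, -, -, -, -, -, -, hℓ1, h5, hΛL⟩ := hm 0 (by
      push_cast
      exact mul_nonneg (mul_nonneg (by positivity) (sq_nonneg _))
        (div_nonneg (Real.rpow_nonneg (Nat.cast_nonneg m) _) (pow_nonneg (logb_two_nonneg m) 5)))
    have hβ1 : 1 ≤ (m : ℝ) ^ (7 / 8 : ℝ) / Real.logb 2 m ^ 5 := by
      rw [le_div_iff₀ (by positivity), one_mul]; exact h5
    have hD1 : ((t : ℝ) + 1) ≤ 2 * ((m : ℝ) ^ (7 / 8 : ℝ) / Real.logb 2 m ^ 5) := by linarith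
    push_cast
    have h0 : (0 : ℝ) ≤ ((Nat.log 2 m : ℝ) + 1) * ((2 * (c : ℝ) + 8) * ((Nat.log 2 m : ℝ) + 1)) := by positivity
    calc ((Nat.log 2 m : ℝ) + 1) * ((2 * (c : ℝ) + 8) * ((Nat.log 2 m : ℝ) + 1)) * ((t : ℝ) + 1)
        ≤ (8 * ((c : ℝ) + 4) * Real.logb 2 m ^ 2) * (2 * ((m : ℝ) ^ (7 / 8 : ℝ) / Real.logb 2 m ^ 5)) :=
          mul_le_mul hΛL hD1 (by positivity) (by positivity)
      _ = 16 * ((c : ℝ) + 4) * Real.logb 2 m ^ 2 * ((m : ℝ) ^ (7 / 8 : ℝ) / Real.logb 2 m ^ 5) := by ring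
  obtain ⟨hm1, hq0, hq1, hhalf, hε, h2t, -, hpos, hB, hmΛ, -, -, -⟩ := hm _ hT
  refine sgAt_linRank_of_chain_budget m _ (kOf m) t _ _ (qOf m) (epsOf c m) hq0 hq1 hhalf hε h2t hpos ?_
  have hV := card_smallSets_le_two_pow m ((2 * c + 8) * (Nat.log 2 m + 1))
  have hVR : (#(smallSets (Fin m) ((2 * c + 8) * (Nat.log 2 m + 1))) : ℝ) ≤
      (2 : ℝ) ^ ((Nat.log 2 m + 1) * ((2 * c + 8) * (Nat.log 2 m + 1))) := by exact_mod_cast hV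
  refine cover_budget_two_pow (a := (Nat.log 2 m + 1) * ((2 * c + 8) * (Nat.log 2 m + 1)) * t)
    (Λ := Nat.log 2 m + 1) hm1 (by positivity) ?_ hVR ?_ hmΛ
  · calc (#(smallSets (Fin m) ((2 * c + 8) * (Nat.log 2 m + 1))) : ℝ) ^ t
        ≤ ((2 : ℝ) ^ ((Nat.log 2 m + 1) * ((2 * c + 8) * (Nat.log 2 m + 1)))) ^ t :=
          pow_le_pow_left₀ (Nat.cast_nonneg _) hVR t
      _ = (2 : ℝ) ^ ((Nat.log 2 m + 1) * ((2 * c + 8) * (Nat.log 2 m + 1)) * t) := (pow_mul _ _ _).symm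
  · have h1 : (Nat.log 2 m + 1) * ((2 * c + 8) * (Nat.log 2 m + 1)) * t +
        (Nat.log 2 m + 1) * ((2 * c + 8) * (Nat.log 2 m + 1)) =
        (Nat.log 2 m + 1) * ((2 * c + 8) * (Nat.log 2 m + 1)) * (t + 1) := by ring
    omega

/-! ### Monotonicity, collapse and the circuit lower bound -/

/-- Rank-threshold gates are monotone: more live vectors, larger span. [folklore] -/
theorem monotone_of_linRank {F : Type} [DivisionRing F] {D θ : ℕ} (g : GateFn) (u : Fin g.1 → (Fin D → F))
    (hg : ∀ v : Fin g.1 → Bool, g.2 v = true ↔ θ ≤ Module.finrank F (Submodule.span F (u '' {i | v i = true}))) :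
    Monotone g.2 :=
  monotone_of_forall_iff hg fun _ _ hvw hv => hv.trans (Submodule.finrank_mono (Submodule.span_mono
    (Set.image_mono fun i hi => eq_true_of_le_of_eq_true (hvw i) hi)))

/-- **Collapse `LINRANK_t ∘ OR ⊆ LINRANK_t`.** A rank-threshold gate fed with small-clique DNFs `⌈A_i⌉`, `A_i ⊆ 𝒱(l)`, is a
rank-threshold term gate over the atoms `X ∈ ⋃ A_i`: repeat the vector `u_i` on every new wire `(i, X)`; the set of live
vectors is unchanged (`image_rewire_eq`). [folklore] -/
theorem isTermGate_linRank_collapse (m l t : ℕ) (g : GateFn) (A : Fin g.1 → Finset (Finset (Fin m)))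
    (hA : ∀ i, A i ⊆ smallSets (Fin m) l)
    (hg : ∃ (F : Type) (_ : DivisionRing F) (D θ : ℕ), θ ≤ t ∧ ∃ u : Fin g.1 → (Fin D → F),
      ∀ v : Fin g.1 → Bool, g.2 v = true ↔ θ ≤ Module.finrank F (Submodule.span F (u '' {i | v i = true}))) :
    IsTermGate m (fun g' => ∃ (F : Type) (_ : DivisionRing F) (D θ : ℕ), θ ≤ t ∧ ∃ u : Fin g'.1 → (Fin D → F),
      ∀ v : Fin g'.1 → Bool, g'.2 v = true ↔ θ ≤ Module.finrank F (Submodule.span F (u '' {i | v i = true}))) l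
      (fun x => g.2 fun i => acceptsB (A i) x) := by
  classical
  obtain ⟨F, _, D, θ, hθt, u, hgu⟩ := hg
  set e := Fintype.equivFin (Σ i : Fin g.1, {X // X ∈ A i}) with he
  set N := Fintype.card (Σ i : Fin g.1, {X // X ∈ A i}) with hN
  set π : Fin N → Fin g.1 := fun a => (e.symm a).1 with hπ
  refine ⟨⟨N, fun w => decide (θ ≤ Module.finrank F (Submodule.span F ((fun a => u (π a)) '' {a | w a = true})))⟩,
    ⟨F, inferInstance, D, θ, hθt, fun a => u (π a), fun w => decide_eq_true_iff⟩,
    fun a => ((e.symm a).2 : Finset (Fin m)), fun a => hA _ (e.symm a).2.2, fun x => ?_⟩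
  change g.2 (fun i => acceptsB (A i) x) = decide (θ ≤ Module.finrank F (Submodule.span F
    ((fun a => u (π a)) '' {a | (fun a => atomB ((e.symm a).2 : Finset (Fin m)) x) a = true})))
  rw [Bool.eq_iff_iff, hgu, decide_eq_true_iff, image_rewire_eq π u (acceptsB_eq_true_iff_exists_atom A e x)]

/-- **No polynomial-size monotone circuit over `{∧₂, ∨₂} ∪ LINRANK_t`, `t ≤ m^{7/8}/(log₂ m)^5`, computes `CLIQUE(m, ⌈m^{1/8}⌉)`
(unconditional).** For every `c`, eventually in `m`, for every such `t` and every circuit `C` with `≤ m^c` gates over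
`{∧₂, ∨₂}` and linear-matroid rank threshold gates `[θ ≤ dim span{u_i : v_i = 1}]`, `θ ≤ t` (vectors in any `F^D` over any
division ring, unbounded fan-in): `¬ C.Computes CLIQUE(m, ⌈m^{1/8}⌉)` — the level-`l` door theorem with `monotone_of_linRank`,
`isTermGate_linRank_collapse` and `sgAt_linRank_logWidth`. [folklore] -/
theorem not_computes_clique_of_isOver_linRank_logWidth : ∀ c : ℕ, ∀ᶠ m : ℕ in atTop, ∀ t : ℕ,
    (t : ℝ) ≤ (m : ℝ) ^ (7 / 8 : ℝ) / Real.logb 2 m ^ 5 →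
    ∀ C : Circuit (KEdge m), C.IsOver ({GateFn.and 2, GateFn.or 2} ∪
      {g : GateFn | ∃ (F : Type) (_ : DivisionRing F) (D θ : ℕ), θ ≤ t ∧ ∃ u : Fin g.1 → (Fin D → F),
        ∀ v : Fin g.1 → Bool, g.2 v = true ↔ θ ≤ Module.finrank F (Submodule.span F (u '' {i | v i = true}))}) →
      C.size ≤ m ^ c → ¬ C.Computes (cliqueFn m ⌈(m : ℝ) ^ (1 / 8 : ℝ)⌉₊) := by
  intro c
  filter_upwards [not_computes_clique_of_collapse_level c, sgAt_linRank_logWidth c, logWidth_le_lOf c]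
    with m hhost hSG hLl t ht C hC hsize
  refine hhost ((2 * c + 8) * (Nat.log 2 m + 1)) (Nat.le_mul_of_pos_right _ (Nat.succ_pos _)) hLl _ _
    (fun g hg => ?_) (fun g hg A hA => isTermGate_linRank_collapse m _ t g A hA hg) (hSG t ht) C hC hsize
  obtain ⟨F, _, D, θ, -, u, hgu⟩ := hg
  exact monotone_of_linRank g u hgu

end Summit.PneNP.PneNP.Theorems

end
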